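import Summits.CriticalPhenomena.PercolationContinuityZ3.Theorems.SahiMasterFamilyRigidityAllSections

/-!
# Rigidity at every order, systems: GOOD voter systems, their sections, and the single-active-voter case

Support file of the master-family programme (crux `NoHeavyLowerTail`, stmt-CriticalPhenomena-4575; cell `prim-masterthm`, seat P4,
unit `prim-masterthm-p4-g8`).  Seat document HOME/prim-masterthm-p4/RIGIDITY-ALLK.md §1–§2.  Third file.

A GOOD SYSTEM (`Good S J V₀ V Q`) on the live coordinates `S`: an increasing target `V₀`, voters `j ∈ J` with increasing `V_j ⊇ V₀` and nonempty
`Q_j`, every event free in the coordinates outside `S`, and the identity `GI J V₀ V Q`.  Voter `j` is ACTIVE when `V_j ∩ Q_j ≠ ∅`.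
* `Good.restrict` — deleting inactive voters keeps a good system;
* `Good.sec0`, `Good.sec1` — the `0`-section (always) and the `1`-section (when no `Q_j` is frozen to `0` at `x`) are good systems on `S ∖ {x}`;
* `secPair_nonempty_iff` — activity of a voter after sectioning;
* **`Good.single`** (part (b) of THEOREM R*) — if `j` is the ONLY active voter then `V₀` and `Q_j` have no common essential coordinate and
  `V_j ∩ Q_j = V₀ ∩ Q_j` (degree count in `ℝ[X_ι]` + independence of disjointly supported events + injectivity of `E(·)`).
HONEST FRAMING: infrastructure; Sahi `C_k` / Kahn's Conj. 5 / the master theorem remain OPEN.  [this work]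
-/

noncomputable section

open scoped Classical

namespace Summit.CriticalPhenomena.PercolationContinuityZ3.Theorems

open Finset Function MvPolynomial
open Literature.Combinatorics.Sahi2008
open Literature.Probability.Percolation.BHK2006 (weight)
open Literature.Probability.Percolation.DecisionTree (ind ind_of_mem ind_of_not_mem ind_nonneg)
open SharedCoordinate (Ignores xInd)
open ExpectationRigidity RigidityR3

namespace RigidityAll

variable {ι : Type*} [Fintype ι] {κ : Type*}

/-! ### Good systems -/

/-- A GOOD voter system on the live coordinates `S` (RIGIDITY-ALLK.md §0: the hypotheses of THEOREM R*, plus determinacy by `S`). [this work] -/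
structure Good (S : Finset ι) (J : Finset κ) (V₀ : Set (Set ι)) (V Q : κ → Set (Set ι)) : Prop where
  up0 : IsUpperSet V₀
  up : ∀ j ∈ J, IsUpperSet (V j)
  sub : ∀ j ∈ J, V₀ ⊆ V j
  ne : ∀ j ∈ J, (Q j).Nonempty
  free0 : ∀ y, y ∉ S → ∀ ω, insert y ω ∈ V₀ ↔ ω ∈ V₀
  freeV : ∀ j ∈ J, ∀ y, y ∉ S → ∀ ω, insert y ω ∈ V j ↔ ω ∈ V j
  freeQ : ∀ j ∈ J, ∀ y, y ∉ S → ∀ ω, insert y ω ∈ Q j ↔ ω ∈ Q j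
  gi : GI J V₀ V Q

variable {S : Finset ι} {J : Finset κ} {V₀ : Set (Set ι)} {V Q : κ → Set (Set ι)}

/-- **Deleting inactive voters keeps a good system.** [this work] -/
theorem Good.restrict (h : Good S J V₀ V Q) {J' : Finset κ} (hJ' : J' ⊆ J) (hz : ∀ j ∈ J, j ∉ J' → V j ∩ Q j = ∅) :
    Good S J' V₀ V Q where
  up0 := h.up0
  up j hj := h.up j (hJ' hj)
  sub j hj := h.sub j (hJ' hj)
  ne j hj := h.ne j (hJ' hj)
  free0 := h.free0
  freeV j hj := h.freeV j (hJ' hj)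
  freeQ j hj := h.freeQ j (hJ' hj)
  gi := h.gi.restrict hJ' h.ne hz

/-- **The `0`-section of a good system is a good system on `S ∖ {x}`.** [this work] -/
theorem Good.sec0 (h : Good S J V₀ V Q) (x : ι) :
    Good (S.erase x) J (secAt x false V₀) (fun j => secAt x (bsec x (Q j)) (V j)) (fun j => secAt x (bsec x (Q j)) (Q j)) where
  up0 := isUpperSet_secAt x false h.up0
  up j hj := isUpperSet_secAt x _ (h.up j hj)
  sub j hj := by
    by_cases hf : secAt x false (Q j) = ∅
    · simp only [bsec_of_eq hf]
      exact (secAt_false_subset_secAt_true x h.up0).trans (secAt_mono x true (h.sub j hj))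
    · simp only [bsec_of_ne hf]
      exact secAt_mono x false (h.sub j hj)
  ne j hj := by
    by_cases hf : secAt x false (Q j) = ∅
    · simp only [bsec_of_eq hf]
      obtain ⟨ω, hω⟩ := h.ne j hj
      exact ⟨ω, mem_secAt_of_mem hω (by simpa using (secAt_false_eq_empty_iff x (Q j)).1 hf ω hω)⟩
    · simp only [bsec_of_ne hf]
      exact Set.nonempty_iff_ne_empty.2 hf
  free0 y hy ω := by
    by_cases hyx : y = x
    · subst hyx; exact insert_mem_secAt_iff y false V₀ ω
    · exact insert_mem_secAt_iff_of_ne hyx false (h.free0 y fun hyS => hy (mem_erase.2 ⟨hyx, hyS⟩)) ω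
  freeV j hj y hy ω := by
    by_cases hyx : y = x
    · subst hyx; exact insert_mem_secAt_iff y _ (V j) ω
    · exact insert_mem_secAt_iff_of_ne hyx _ (h.freeV j hj y fun hyS => hy (mem_erase.2 ⟨hyx, hyS⟩)) ω
  freeQ j hj y hy ω := by
    by_cases hyx : y = x
    · subst hyx; exact insert_mem_secAt_iff y _ (Q j) ω
    · exact insert_mem_secAt_iff_of_ne hyx _ (h.freeQ j hj y fun hyS => hy (mem_erase.2 ⟨hyx, hyS⟩)) ω
  gi := gi_sec0 h.gi x

/-- **The `1`-section of a good system with no voter frozen to `0` at `x` is a good system on `S ∖ {x}`.** [this work] -/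
theorem Good.sec1 (h : Good S J V₀ V Q) (x : ι) (hQ : ∀ j ∈ J, (secAt x true (Q j)).Nonempty) :
    Good (S.erase x) J (secAt x true V₀) (fun j => secAt x true (V j)) (fun j => secAt x true (Q j)) where
  up0 := isUpperSet_secAt x true h.up0
  up j hj := isUpperSet_secAt x true (h.up j hj)
  sub j hj := secAt_mono x true (h.sub j hj)
  ne := hQ
  free0 y hy ω := by
    by_cases hyx : y = x
    · subst hyx; exact insert_mem_secAt_iff y true V₀ ω
    · exact insert_mem_secAt_iff_of_ne hyx true (h.free0 y fun hyS => hy (mem_erase.2 ⟨hyx, hyS⟩)) ω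
  freeV j hj y hy ω := by
    by_cases hyx : y = x
    · subst hyx; exact insert_mem_secAt_iff y true (V j) ω
    · exact insert_mem_secAt_iff_of_ne hyx true (h.freeV j hj y fun hyS => hy (mem_erase.2 ⟨hyx, hyS⟩)) ω
  freeQ j hj y hy ω := by
    by_cases hyx : y = x
    · subst hyx; exact insert_mem_secAt_iff y true (Q j) ω
    · exact insert_mem_secAt_iff_of_ne hyx true (h.freeQ j hj y fun hyS => hy (mem_erase.2 ⟨hyx, hyS⟩)) ω
  gi := gi_sec1 h.gi x

omit [Fintype ι] in
/-- **Activity after sectioning**: voter `j` is active in the `b`-section iff `V_j ∩ Q_j` has an element with `x`-status `b`. [this work] -/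
theorem secPair_nonempty_iff (x : ι) (b : Bool) (A B : Set (Set ι)) :
    (secAt x b A ∩ secAt x b B).Nonempty ↔ ∃ ω ∈ A ∩ B, (x ∈ ω ↔ b = true) := by
  rw [← secAt_inter, secAt_nonempty_iff]

/-! ### Determinacy: an event free outside `S` is determined by `ω ∩ S` -/

/-- **An event free in every coordinate outside `S` is determined by `ω ∩ S`.** [this work] -/
theorem mem_iff_of_inter_eq {A : Set (Set ι)} {T : Finset ι} (hA : ∀ y, y ∉ T → ∀ ω, insert y ω ∈ A ↔ ω ∈ A) {ω ω' : Set ι}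
    (h : ω ∩ ↑T = ω' ∩ ↑T) : ω ∈ A ↔ ω' ∈ A :=
  mem_iff_of_ind_eq (apply_eq_of_inter_eq (fun y hy => SharedCoordinate.ignores_ind_of_forall_iff (hA y hy)) h)

/-! ### Part (b): a single active voter -/

/-- The target of a good system with an active voter is nonempty. [this work] -/
theorem Good.target_nonempty (h : Good S J V₀ V Q) {j : κ} (hj : j ∈ J) (hact : (V j ∩ Q j).Nonempty)
    (hothers : ∀ l ∈ J, l ≠ j → V l ∩ Q l = ∅) : V₀.Nonempty := by
  have hgi : GI {j} V₀ V Q :=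
    h.gi.restrict (singleton_subset_iff.2 hj) h.ne fun l hl hlj => hothers l hl (by simpa using hlj)
  have hs := hgi.single
  by_contra h0
  rw [Set.not_nonempty_iff_eq_empty] at h0
  rw [h0, ind_empty_eq, exPoly_zero, zero_mul] at hs
  exact exPoly_ind_ne_zero hact hs

/-- **Part (b) of THEOREM R*.**  If `j` is the only active voter of a good system, then no coordinate is essential for both `V₀` and `Q_j`,
and `V_j ∩ Q_j = V₀ ∩ Q_j`. [this work] -/
theorem Good.single (h : Good S J V₀ V Q) {j : κ} (hj : j ∈ J) (hact : (V j ∩ Q j).Nonempty)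
    (hothers : ∀ l ∈ J, l ≠ j → V l ∩ Q l = ∅) :
    (∀ y, Ignores y (ind V₀) ∨ Ignores y (ind (Q j))) ∧ V j ∩ Q j = V₀ ∩ Q j := by
  have hgi : GI {j} V₀ V Q :=
    h.gi.restrict (singleton_subset_iff.2 hj) h.ne fun l hl hlj => hothers l hl (by simpa using hlj)
  have hs := hgi.single
  have hV₀ := h.target_nonempty hj hact hothers
  -- degree count: a coordinate essential for both `V₀` and `Q_j` gives degree 2 on the right, ≤ 1 on the left
  have hor : ∀ y, Ignores y (ind V₀) ∨ Ignores y (ind (Q j)) := by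
    intro y
    by_contra hy
    push Not at hy
    have hdeg : degreeOf y (exPoly (ind V₀) * exPoly (ind (Q j))) = 2 := by
      rw [degreeOf_mul_eq (exPoly_ind_ne_zero hV₀) (exPoly_ind_ne_zero (h.ne j hj)), degreeOf_exPoly_eq_one_of_not_ignores hy.1,
        degreeOf_exPoly_eq_one_of_not_ignores hy.2]
    have hle := degreeOf_exPoly_le (ind (V j ∩ Q j)) y
    rw [hs, hdeg] at hle
    omega
  refine ⟨hor, ?_⟩
  have hmul : exPoly (ind V₀ * ind (Q j)) = exPoly (ind V₀) * exPoly (ind (Q j)) := exPoly_ind_mul_eq_of_ignores hor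
  rw [← hs, ← ind_inter_eq_mul] at hmul
  exact (eq_of_ind_eq (exPoly_injective hmul)).symm

end RigidityAll

end Summit.CriticalPhenomena.PercolationContinuityZ3.Theorems
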